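import Mathlib
import HarnessLib
import Summits.HubbardSuperconductivity.HubbardSuperconductivity.Theorems.KLProgrammeC4aValueBridgeGeometry
import Summits.HubbardSuperconductivity.HubbardSuperconductivity.Theorems.KLProgrammeC4aPartnerBandCooperDefect
import Summits.HubbardSuperconductivity.HubbardSuperconductivity.Theorems.KLProgrammeC4aLoopAlignmentSheets

/-!
# Route `KLProgramme` — crux C4a, S3 brick (B4) «(B4)-UMK1», part 7: the LEVEL RATE of the partner band near a caustic of any sheet —
# `∂_e ē(e,α) = −1 + O(‖X − 2πm − 2Φ(e,α)‖)` (external tangency: the normals at the loop point and at its partner are parallel)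

Cell `gate-hubbard-kl`, seat hubbard-kl-k3c3-p3 (g27; row «implicit-function / monotonicity route for μ(n)»).  Located brick for the (C)-closer lane
hubbard-kl-c4a-1 (stub (C) `stub_twoLeg_curvature` of `KLRegimeEngineV17F2`, stmt-HubbardSuperconductivity-20437), design note HOME/hubbard-kl-k3c3-p3/B4-UMK1-DESIGN.md
§4 (b′)/§6: the rate hypothesis of `…C4aFoldValueDrift.fold_value_drift` / `…C4aFoldLevelLayer` (`∂_eē ∈ [−λ₂, −λ₁]`) for the ACTUAL partner band
`ē(e,α) = e_K(X − Φ(e,α))` (`X = S` or `S − 2πm`):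
* §1 `fderiv_frameLevel_levelVel_eq_one` (`De_K(Φ(ρ,ϑ))[∂_ρΦ(ρ,ϑ)] = 1` on the tube: `e_K ∘ Φ(·,ϑ) = id`), `hasDerivAt_partnerBand_level`
  (`∂_e e_K(X − Φ(e,α)) = −De_K(X − Φ(e,α))[∂_ρΦ(e,α)]`);
* §2 **`abs_deriv_partnerBand_level_add_one_le`**: for a period `v` of `e_K`, `|∂_eē(e,α) + 1| ≤ K₂·‖X − v − 2Φ(e,α)‖/(Dt−2A)` — the rate is `−1` up to the
  distance of the configuration from the caustic of the sheet `v` measured AT the loop point;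
* §3 **`partnerBand_level_rate_window`**: hence on a window where `K₂·‖X − v − 2Φ(e,α)‖/(Dt−2A) ≤ 1/2` the partner band DECREASES in the level at rates in
  `[−3/2, −1/2]`: `−(3/2)(e − e′) ≤ ē(e,α) − ē(e′,α) ≤ −(1/2)(e − e′)` for `e′ ≤ e` — the `hrate` of `fold_value_drift` (`λ₁ = 1/2`, `λ₂ = 3/2`).
Sizes binder shape + `K₂` row; nothing about the model's sizes beyond clause (i) of `FrameOK`; nothing asserts (C), K3 or superconductivity.
References: FST II CPAM 51 (1998) §2.1, §3 [cite: FeldmanSalmhoferTrubowitz1998].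
-/

noncomputable section

namespace Summit.HubbardSuperconductivity.HubbardSuperconductivity.Theorems.C4a

set_option linter.dupNamespace false -- summit = problem name (single-conjunct summit), D-0017

open Real Set
open Literature.MathematicalPhysics.QuantumLattice Literature.MathematicalPhysics.QuantumLattice.BandSectorCounting
open Literature.MathematicalPhysics.QuantumLattice.FermiRG
open Summit.HubbardSuperconductivity.HubbardSuperconductivity.Theorems.KLRegimeSplit
open Summit.HubbardSuperconductivity.HubbardSuperconductivity.Theorems.DispersionFlow
open Summit.HubbardSuperconductivity.HubbardSuperconductivity.Theorems.PerturbedFermiCurve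

section Sizes

variable {K : TrigPolyC4v} {A : ℝ} (hA : ∀ p : Momentum, ∀ j ≤ 2, ‖iteratedFDeriv ℝ j (frameShift K) p‖ ≤ A) (hA20 : A ≤ 1 / 20)
  (hd : klCurveD ≤ (bandBounds (show (-4 : ℝ) < -1.1 by norm_num) (show (-1.1 : ℝ) ≤ -0.1 by norm_num)
    (show (-0.1 : ℝ) < 0 by norm_num)).Dtmin - 2 * A)
  {μ r : ℝ} (hr : 0 < r) (hlo : (-1.1 : ℝ) < μ - r - A) (hhi : μ + r + A < -0.1)
  {K₂ : ℝ} (hK₂ : ∀ p : Momentum, ‖iteratedFDeriv ℝ 2 (frameLevel μ K) p‖ ≤ K₂)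
include hA hA20 hd hr hlo hhi hK₂

/-! ## §1 The level velocity of the chart and the level derivative of the partner band -/

omit hA20 hr hK₂ in
/-- **`De_K(Φ(ρ,ϑ))[∂_ρΦ(ρ,ϑ)] = 1`** for `|ρ| < r`: the level coordinate IS the band (`e_K(Φ(ρ,ϑ)) = ρ`). -/
theorem fderiv_frameLevel_levelVel_eq_one {ρ : ℝ} (hρ : |ρ| < r) (ϑ : ℝ) :
    fderiv ℝ (frameLevel μ K) (levelPoint μ K ρ ϑ)
        (WithLp.toLp 2 (deriv (fun m : ℝ => perturbedFermiRadius (fun k : Fin 2 → ℝ => -K.eval k) m ϑ) (μ + ρ) • dir ϑ)) = 1 := by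
  set B₀ := bandBounds (show (-4 : ℝ) < -1.1 by norm_num) (show (-1.1 : ℝ) ≤ -0.1 by norm_num) (show (-0.1 : ℝ) < 0 by norm_num) with hB₀
  have hADt : 2 * A < B₀.Dtmin := by have := klCurveD_pos; linarith
  have hρI : ρ ∈ Ioo (-r) r := ⟨(abs_lt.1 hρ).1, (abs_lt.1 hρ).2⟩
  have hΦ := hasDerivAt_levelPoint_level B₀ hA hADt hlo hhi hρI ϑ
  have hE : DifferentiableAt ℝ (frameLevel μ K) (levelPoint μ K ρ ϑ) := ((EngineV8.contDiff_frameLevel μ K (n := 1)).differentiable one_ne_zero) _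
  have hcomp := hE.hasFDerivAt.comp_hasDerivAt ρ hΦ
  -- the composite is the identity near `ρ`
  have hid : HasDerivAt (fun s : ℝ => frameLevel μ K (levelPoint μ K s ϑ)) 1 ρ := by
    have hev : (fun s : ℝ => frameLevel μ K (levelPoint μ K s ϑ)) =ᶠ[nhds ρ] fun s => s := by
      have hopen : IsOpen (Ioo (-r) r) := isOpen_Ioo
      filter_upwards [hopen.mem_nhds hρI] with s hs
      exact frameLevel_levelPoint_tube B₀ hA hlo hhi (abs_lt.2 ⟨hs.1, hs.2⟩) ϑ
    exact (hasDerivAt_id ρ).congr_of_eventuallyEq hev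
  exact hcomp.unique hid

omit hA20 hr hK₂ in
/-- **Level derivative of the partner band**: `∂_e e_K(X − Φ(e,α)) = −De_K(X − Φ(e,α))[∂_ρΦ(e,α)]` for `|e| < r`. -/
theorem hasDerivAt_partnerBand_level (X : Momentum) {e : ℝ} (he : |e| < r) (α : ℝ) :
    HasDerivAt (fun s : ℝ => frameLevel μ K (X - levelPoint μ K s α))
      (-fderiv ℝ (frameLevel μ K) (X - levelPoint μ K e α)
        (WithLp.toLp 2 (deriv (fun m : ℝ => perturbedFermiRadius (fun k : Fin 2 → ℝ => -K.eval k) m α) (μ + e) • dir α))) e := by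
  set B₀ := bandBounds (show (-4 : ℝ) < -1.1 by norm_num) (show (-1.1 : ℝ) ≤ -0.1 by norm_num) (show (-0.1 : ℝ) < 0 by norm_num) with hB₀
  have hADt : 2 * A < B₀.Dtmin := by have := klCurveD_pos; linarith
  have heI : e ∈ Ioo (-r) r := ⟨(abs_lt.1 he).1, (abs_lt.1 he).2⟩
  have hΦ := hasDerivAt_levelPoint_level B₀ hA hADt hlo hhi heI α
  have hin : HasDerivAt (fun s : ℝ => X - levelPoint μ K s α)
      (-(WithLp.toLp 2 (deriv (fun m : ℝ => perturbedFermiRadius (fun k : Fin 2 → ℝ => -K.eval k) m α) (μ + e) • dir α))) e := by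
    have h := (hasDerivAt_const e X).sub hΦ
    rwa [zero_sub] at h
  have hE : DifferentiableAt ℝ (frameLevel μ K) (X - levelPoint μ K e α) := ((EngineV8.contDiff_frameLevel μ K (n := 1)).differentiable one_ne_zero) _
  have h := hE.hasFDerivAt.comp_hasDerivAt e hin
  rwa [map_neg] at h

/-! ## §2 The rate is `−1` up to the caustic distance -/

omit hA20 hr in
/-- **THE LEVEL RATE NEAR A CAUSTIC OF THE SHEET `v`**: for a period `v` of `e_K`, `|e| < r` and any `X, α`:
`|∂_e e_K(X − Φ(e,α)) + 1| ≤ K₂·‖X − v − 2Φ(e,α)‖/(Dt−2A)`.  (`∂_eē + 1 = −(De_K(X − Φ − v) − De_K(Φ))[∂_ρΦ]`, `‖∂_ρΦ‖ ≤ 1/(Dt−2A)`.) -/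
theorem abs_deriv_partnerBand_level_add_one_le {v : Momentum} (hv : ∀ q : Momentum, frameLevel μ K (q + v) = frameLevel μ K q)
    (X : Momentum) {e : ℝ} (he : |e| < r) (α : ℝ) :
    |deriv (fun s : ℝ => frameLevel μ K (X - levelPoint μ K s α)) e + 1| ≤
      K₂ * ‖X - v - (2 : ℝ) • levelPoint μ K e α‖ /
        ((bandBounds (show (-4 : ℝ) < -1.1 by norm_num) (show (-1.1 : ℝ) ≤ -0.1 by norm_num) (show (-0.1 : ℝ) < 0 by norm_num)).Dtmin - 2 * A) := by
  set B₀ := bandBounds (show (-4 : ℝ) < -1.1 by norm_num) (show (-1.1 : ℝ) ≤ -0.1 by norm_num) (show (-0.1 : ℝ) < 0 by norm_num) with hB₀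
  have hADt : 2 * A < B₀.Dtmin := by have := klCurveD_pos; linarith
  have hDt : 0 < B₀.Dtmin - 2 * A := by linarith
  have heI : e ∈ Ioo (-r) r := ⟨(abs_lt.1 he).1, (abs_lt.1 he).2⟩
  set V : Momentum := WithLp.toLp 2 (deriv (fun m : ℝ => perturbedFermiRadius (fun k : Fin 2 → ℝ => -K.eval k) m α) (μ + e) • dir α) with hV
  set p : Momentum := levelPoint μ K e α with hp
  rw [(hasDerivAt_partnerBand_level hA hd hlo hhi X he α).deriv]
  have hone := fderiv_frameLevel_levelVel_eq_one hA hd hlo hhi he α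
  rw [← hV, ← hp] at hone ⊢
  -- shift the partner by the period
  have hper : fderiv ℝ (frameLevel μ K) (X - p) = fderiv ℝ (frameLevel μ K) (X - p - v) := by
    have h := fderiv_frameLevel_add_period μ K hv (X - p - v)
    rw [sub_add_cancel] at h
    exact h
  have hexpr : -fderiv ℝ (frameLevel μ K) (X - p) V + 1 = -((fderiv ℝ (frameLevel μ K) (X - p - v) - fderiv ℝ (frameLevel μ K) p) V) := by
    rw [hper, show (fderiv ℝ (frameLevel μ K) (X - p - v) - fderiv ℝ (frameLevel μ K) p) V = fderiv ℝ (frameLevel μ K) (X - p - v) V - fderiv ℝ (frameLevel μ K) p V from rfl, hone]; ring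
  rw [hexpr, abs_neg, ← Real.norm_eq_abs]
  have hL := norm_fderiv_frameLevel_sub_le hK₂ (X - p - v) p
  have hVn : ‖V‖ ≤ (B₀.Dtmin - 2 * A)⁻¹ := norm_levelVel_le B₀ hA hADt hlo hhi heI α
  have hK₂0 : 0 ≤ K₂ := (norm_nonneg _).trans (hK₂ 0)
  calc ‖(fderiv ℝ (frameLevel μ K) (X - p - v) - fderiv ℝ (frameLevel μ K) p) V‖
      ≤ ‖fderiv ℝ (frameLevel μ K) (X - p - v) - fderiv ℝ (frameLevel μ K) p‖ * ‖V‖ := ContinuousLinearMap.le_opNorm _ _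
    _ ≤ K₂ * ‖X - p - v - p‖ * (B₀.Dtmin - 2 * A)⁻¹ := mul_le_mul hL hVn (norm_nonneg _) (by positivity)
    _ = K₂ * ‖X - v - (2 : ℝ) • p‖ / (B₀.Dtmin - 2 * A) := by
        rw [show X - p - v - p = X - v - (2 : ℝ) • p by rw [two_smul]; abel, div_eq_mul_inv]

/-! ## §3 The rate window -/

omit hA20 hr in
/-- **RATE WINDOW**: if `K₂·‖X − v − 2Φ(s,α)‖/(Dt−2A) ≤ 1/2` for all levels `s` of `[e′, e] ⊂ (−r, r)`, then
`−(3/2)(e − e′) ≤ e_K(X − Φ(e,α)) − e_K(X − Φ(e′,α)) ≤ −(1/2)(e − e′)` — the `hrate` of `…C4aFoldValueDrift.fold_value_drift` with `λ₁ = 1/2`, `λ₂ = 3/2`. -/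
theorem partnerBand_level_rate_window {v : Momentum} (hv : ∀ q : Momentum, frameLevel μ K (q + v) = frameLevel μ K q) (X : Momentum) (α : ℝ)
    {e' e : ℝ} (he'e : e' ≤ e) (he' : -r < e') (her : e < r)
    (hwin : ∀ s ∈ Icc e' e, K₂ * ‖X - v - (2 : ℝ) • levelPoint μ K s α‖ /
        ((bandBounds (show (-4 : ℝ) < -1.1 by norm_num) (show (-1.1 : ℝ) ≤ -0.1 by norm_num) (show (-0.1 : ℝ) < 0 by norm_num)).Dtmin - 2 * A) ≤ 1 / 2) :
    -(3 / 2) * (e - e') ≤ frameLevel μ K (X - levelPoint μ K e α) - frameLevel μ K (X - levelPoint μ K e' α) ∧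
      frameLevel μ K (X - levelPoint μ K e α) - frameLevel μ K (X - levelPoint μ K e' α) ≤ -(1 / 2) * (e - e') := by
  set f : ℝ → ℝ := fun s => frameLevel μ K (X - levelPoint μ K s α) with hf
  have hsr : ∀ s ∈ Icc e' e, |s| < r := fun s hs => abs_lt.2 ⟨by linarith [hs.1], by linarith [hs.2]⟩
  have hderiv : ∀ s ∈ Icc e' e, -(3 / 2) ≤ deriv f s ∧ deriv f s ≤ -(1 / 2) := fun s hs => by
    have h := abs_deriv_partnerBand_level_add_one_le hA hd hlo hhi hK₂ hv X (hsr s hs) α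
    have h' := h.trans (hwin s hs)
    have h1 := (abs_le.1 h').1
    have h2 := (abs_le.1 h').2
    exact ⟨by rw [hf]; linarith, by rw [hf]; linarith⟩
  have hdiff : ∀ s ∈ Icc e' e, DifferentiableAt ℝ f s := fun s hs => (hasDerivAt_partnerBand_level hA hd hlo hhi X (hsr s hs) α).differentiableAt
  have hcont : ContinuousOn f (Icc e' e) := fun s hs => (hdiff s hs).continuousAt.continuousWithinAt
  have hdiff' : DifferentiableOn ℝ f (interior (Icc e' e)) := fun s hs => (hdiff s (interior_subset hs)).differentiableWithinAt
  have hlow := (convex_Icc e' e).mul_sub_le_image_sub_of_le_deriv hcont hdiff' (fun s hs => (hderiv s (interior_subset hs)).1)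
    e' (left_mem_Icc.2 he'e) e (right_mem_Icc.2 he'e) he'e
  have hup := (convex_Icc e' e).image_sub_le_mul_sub_of_deriv_le hcont hdiff' (fun s hs => (hderiv s (interior_subset hs)).2)
    e' (left_mem_Icc.2 he'e) e (right_mem_Icc.2 he'e) he'e
  exact ⟨by simpa [hf] using hlow, by simpa [hf] using hup⟩

end Sizes

end Summit.HubbardSuperconductivity.HubbardSuperconductivity.Theorems.C4a

end
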